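import Literature.MathematicalPhysics.QuantumFieldTheory.Balaban1983to89.T4OutputRate
import Literature.MathematicalPhysics.QuantumFieldTheory.Balaban1983to89.T4TowerRateComposition

/-!
# T4OutputRateWitness (v1.2) — SHARPNESS of the node-U3 three-bracket bound `T4OutputRate.u3_threeBrackets` and the cell
objection GAPS G-t4-U3-6 ("fading memory of the coupling-history moduli is LOAD-BEARING for the carver's U3 target shape")
MADE KERNEL on toy carriers (cell `pub-balaban`, T4-DAG node U3, record `t4/T4-EST-U3.md` §0(e), §4; harness hygiene and
negative knowledge about the cell's OWN hypothesis shapes — NOT an estimate of the manuscripts, NOT summit progress)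

HONEST FRAMING (T4-DAG v1 PAGE 1).  The cell's T4 target is rung (B)+1 — existence AND uniqueness of the ε → 0 limit of
Bałaban's unit-scale averaged expectations on a FIXED finite torus — strictly beyond ultraviolet stability
([Balaban1988Convergent] Cor. 3 p. 264), and NOT infinite volume, NOT a mass gap, NOT the Clay problem.  Node U3 compares
the scale-j terms `E^{(j),A}(X; g^A, U^A)` / `E^{(j+1),B}(X; g^B, U^B)` of two renormalization-group runs; the cell's typing
module `T4OutputRate` (this lineage, v1.1) records the HYPOTHESIS SHAPES NE9 (coupling-history Lipschitz moduli `Λ j i`),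
`LipBackground`, NE5 (η-rate at fixed arguments), `FadingMemory` (`Λ j i ≤ C₉ω^{j−i}`) and the printed uniform bound
`DecayBound` ((0.25) p. 257 / (1.18) p. 263 of [Balaban1987RG1]: *"|E^{(j)}(X, U)| ≤ E₀ exp(−κd_j(X))"*, *"the above bound
is uniform in the lattice spacing ε"* p. 259), and proves the bookkeeping `u3_threeBrackets` / `u3_geometric`: the
difference of the two runs' terms is at most (argument bracket + coupling bracket + functional bracket) × e^{−κd_j(X)}, and
has the carver's TARGET SHAPE `E₀′θ^j e^{−κd_j(X)}` as soon as the argument and coupling brackets are themselves `≤ a·θ^j`,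
`≤ b·θ^j`.  NOTHING of this comparison is printed ([Balaban1987RG1] prints, about the coupling dependence, only p. 263 *"It is
a C^∞-function of g_{j−1} ∈ [0, γ], (or analytic)"* and p. 256 *"The function E_k depends also on the effective coupling
constants g₀, …, g_{k−1}"*; cell GAPS G-t4-U3-1, G-t4-U3-3, G-t4-U3-6, located absences `t4/T4-XREAD-U3.md` §3).

WHAT THIS LEAF DOES (kernel facts about the SHAPES, on toy carriers `toyC`: domains = creation steps, `scale = id`, no tree
length `d ≡ 0` so the printed decay factor is `1`, both runs' backgrounds real numbers, gauge `|U − U′|`, transport `id`;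
functionals = a background term `a·U` plus a LINEAR HISTORY READ-OUT `Σ_{i<j} Λ j i·g_i`, run B shifted by the functional
bracket `−C₅θ^j`):
* §2–§3 SHARPNESS of `u3_threeBrackets`: its hypotheses NE9 (moduli `Λ ≥ 0`), `LipBackground` (constant `a`) and NE5 hold
  for the toy pair (`ne9_EA`, `lipBackground_EA`, `ne5_EA_EB`), and for ordered data (`g^B ≤ g^A` coordinatewise,
  `U^B ≤ U^A`) its conclusion holds WITH EQUALITY, with `δ` the actual gauge distance (`u3_threeBrackets_attained`): the two
  triangle inequalities of node U3 lose nothing in general — any improvement of U3's output must come from the INPUTS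
  (NE3's δ, node U2's discrepancies, the moduli), not from the bookkeeping.
* §4 GAPS G-t4-U3-6 MADE KERNEL, in the STRONG form.  With BIRTH-INDEXED moduli `uvMod ℓ θ j i = ℓ·θ^i` (summable along
  every row, `Σ_i ℓθ^i ≤ ℓ(1−θ)⁻¹`, bounded by `ℓ`, but CONSTANT IN THE AGE `j − i`) the toy pair meets EVERY hypothesis of
  `u3_threeBrackets` / `u3_geometric` except the coupling-bracket rate `hb` — NE9, `LipBackground` (constant 0), NE5 at rate
  `θ` with any `C₅ ≥ 0`, exact backgrounds (`δ = 0`, so `ha` holds with `a = 0`) — AND the printed uniform bound `DecayBound`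
  for BOTH runs (`decayBound_EA_uv`, `decayBound_EB_uv`) AND node U2's output shape at rate θ for the couplings
  (`|gHi i − gLo i| = (γ/2)·θ^i`, both sequences in the window `]0, γ]`); yet the difference of the two runs' scale-j terms is
  `ℓ(γ/2)·Σ_{i<j}θ^{2i} + C₅θ^j ≥ ℓγ/2` for every `j ≥ 1` (`runDiff_eq`, `runDiff_ge`), so the carver's target shape
  `E₀′·ν^j·e^{−κd_j}` FAILS FOR EVERY CONSTANT `E₀′` AND EVERY RATE `ν ∈ [0, 1)` (`u3Target_fails`), the `hb` input of
  `u3_geometric` fails for every `b` (`couplingBracket_not_atRate`), and — the structural point — NO moduli family `Λ′`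
  validating NE9 for run A on the window has `FadingMemory C₉ ω Λ′` with any `ω < 1` and any `C₉` (`moduli_floor`:
  every NE9-moduli family has `Λ′ j 0 ≥ ℓ` for `j ≥ 1`; `not_fadingMemory_of_ne9`).  Packaged: `fadingMemory_loadBearing`.
  READING: what node U3's target needs from NE9 is decay of the moduli in the AGE `j − i` (`FadingMemory`, under which the
  tree's `T4TowerRateComposition.historySum_le_rate` / `historySum_le_rate_of_lt` (unit t4-ne7-p1) give the coupling bracket
  at rate `max(ω, θ) < ν`), NOT summability or uniform boundedness of the moduli, and NOT the printed uniform bound (1.18):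
  all of the latter hold here and the target fails.  The dichotomy `historySum_const` vs `historySum_le_of_fadingMemory` of
  `T4OutputRate` §3 compared upper bounds; this leaf exhibits the failing INHABITANT.
* §5 (contrast, one line): AGE-indexed moduli `ℓ·ω^{j−i}` do have `FadingMemory ℓ ω` (`fadingMemory_ageMod`) — the regime
  of the tree's rate lemmas just named (not re-proved; their module is imported only from v1.2 on, for §7).
* §6 (v1.1) EQUAL RATES — THE LINEAR LOSS IS ATTAINED.  With AGE-indexed moduli AT THE NE5 RATE, `ageMod ℓ θ j i = ℓ·θ^{j−i}`
  (so `FadingMemory ℓ θ` HOLDS, with `ω = θ`), and node U2's discrepancy shape `(γ/2)·θ^i`, every summand of the coupling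
  bracket is the SAME number `ℓ(γ/2)·θ^j` (`ageTerm_abs_eq`), so the bracket is EXACTLY `ℓ(γ/2)·j·θ^j`
  (`couplingBracket_age_eq`): the instance `C₉ = ℓ`, `D = γ/2`, `ω = θ` of the tree's `T4TowerRateComposition.historySum_le_maxRate`
  (unit t4-ne7-p1: `≤ C₉·D·j·(max ω θ)^j`; not restated) holds WITH EQUALITY (`maxRate_bound_attained`, stated over `max θ θ`
  literally).  Consequently, although EVERY hypothesis of `u3_threeBrackets` / `u3_geometric` except `hb` holds together with
  `FadingMemory` at rate `ω = θ` and `DecayBound` for both runs (`decayBound_EA_age`, `decayBound_EB_age`), the `hb` of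
  `u3_geometric` at the NE5 rate θ fails for every constant `b` (`couplingBracket_age_not_atRate`) and the carver's target
  shape AT RATE θ fails for every `E₀′` (`u3Target_fails_atRate`; the two runs' terms differ by exactly
  `(ℓ(γ/2)·j + C₅)·θ^j`, `runDiff_age_eq`).  Packaged: `equalRate_linearLoss`.  READING: the factor LINEAR IN THE CUTOFF in
  the constant `a + C₉D(K+1) + C₅` of the tree's `T4TowerRateComposition.uRateUpTo_tower_linear` (case `ω ≤ θ`) cannot be
  removed at rate θ — a K-uniform constant needs a strictly worse rate `ν > max(ω, θ)` (the tree's `historySum_le_rate_of_lt`,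
  not re-proved here) or fading memory strictly FASTER than the η-rate (`ω < θ`, the tree's `historySum_le_rate`).  §4 showed
  the target fails at EVERY rate without fading memory; §6 calibrates the equal-rate borderline.
* §7 (v1.2) THE MEMORY-RATE THRESHOLD.  On the age-indexed family with a general memory rate, `ageMod ℓ ω j i = ℓ·ω^{j−i}`
  (`FadingMemory ℓ ω`), and node U2's discrepancy shape at the η-rate θ, the two runs' scale-j terms differ by
  `ℓ(γ/2)·S_j + C₅θ^j` with the MIXED GEOMETRIC SUM `S_j = Σ_{i<j} ω^{j−i}θ^i` (`runDiff_ageMod_eq`; recursion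
  `mixedSum_succ`, closed form `ω(θ^j − ω^j)/(θ − ω)` off the diagonal, `mixedSum_closed`).  FAST memory `ω < θ`:
  `S_j ≤ (ω/(θ−ω))·θ^j` uniformly in j (the tree's `T4TowerRateComposition.conv_le_of_lt`, unit t4-ne7-p1, IMPORTED AND
  USED BY NAME from v1.2 on — the constant of its `historySum_le_rate` — and that constant is SHARP as a supremum over j,
  `mixedSum_const_sharp`); SLOW memory `θ ≤ ω`: `S_j ≥ j·θ^j`
  (`mixedSum_ge`).  Hence the carver's target shape AT THE NE5 RATE θ holds (`∃ E₀′ ∀ j`) IF AND ONLY IF `ω < θ`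
  (`u3Target_atRate_iff`), while `DecayBound` (both runs, `decayBound_EA_ageMod` / `decayBound_EB_ageMod`), NE9, `FadingMemory ℓ ω`,
  `LipBackground`, NE5 and the window data hold for EVERY `ω ∈ [0, 1)`.  Packaged: `memoryRate_threshold`.  READING: on this
  family the hypothesis `ω < θ` of the tree's `historySum_le_rate` is NECESSARY, not only sufficient, for a cutoff-uniform
  node-U3 output at the NE5 rate — what NE9-FADE (GAPS G-ne9p2-3) must deliver is memory fading STRICTLY faster than the
  η-convergence; §6 is the boundary case `ω = θ`, §4 the extreme case of no fading memory.

WHAT IT DOES NOT DO.  It closes NO estimate of [I]–[III] and moves no count (cell rule D9).  The toy functionals are NOT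
models of Bałaban's `E^{(j)}(X; g, U)` ((2.13) p. 268 of [Balaban1987RG1]); birth-indexed moduli are the OPPOSITE of what
the irrelevance bounds (0.27)/(0.29) p. 258 suggest (heuristic `ω = L^{−α}`-type ageing; loci: (0.27) in cell GAPS C-pv05g4-5,
(0.29)–(0.30) and the reading in C-b12g6-3 — XREAD C-pv04g24-2, I3) — the point is
exactly that the DISPLAYED hypothesis shapes of node U3 other than `FadingMemory` do not exclude them.  The located walls
NE5 / NE9 / NE9-FADE (GAPS G-t4-U3-1, -3, G-ne9p2-3) are untouched.

ABSOLUTE RULE respected: nothing is cited as a fact; [Balaban1987RG1] = T. Bałaban, *Renormalization group approach to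
lattice gauge field theories. I*, Commun. Math. Phys. **109**, 249–301 (1987) (cell paper B12 = [I]; held
`paper:balaban1987-cmp109-rg-i-small-field`) and [Balaban1988Convergent] = T. Bałaban, *Convergent renormalization
expansions for lattice gauge theories*, Commun. Math. Phys. **119**, 243–285 (1988) (B14 = [III]) are quoted for the TYPES
the toy data inhabit, by page, from the loci certified in `T4OutputRate`'s citation header (GAPS C-pv05g4-5); the manuscripts
are UNDER ADJUDICATION by the audit cell `pub-balaban` and NOTHING printed in them is asserted here.  Everything below is
kernel-proved from Mathlib and the imported typing module.  NEW leaf of unit `b2b-balaban-pv05-g17` (SURGE NODE PROVER #05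
gen 17, journal claim PV05-U3-WITNESS 2026-08-19); v1–v1.1 import `T4OutputRate` only; from v1.2 also
`T4TowerRateComposition` (unit t4-ne7-p1; its `conv_le_of_lt` is used BY NAME in §7, nothing of it is restated; the words
"not imported (here)" in the byte-frozen §5/§6 docstrings below describe v1–v1.1); modifies nothing.  v1.1 (same unit,
journal claim PV05-U3-WITNESS v1.1): §6 appended; §1–§5 byte-identical to v1 (p192767).  v1.2 (same unit, journal claim
PV05-U3-WITNESS v1.2): §7 appended; §1–§6 byte-identical to v1.1 (p193089).
-/

noncomputable section

namespace Literature.MathematicalPhysics.QuantumFieldTheory.Balaban1983to89.T4OutputRateWitness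

open Finset
open Literature.MathematicalPhysics.QuantumFieldTheory.Balaban1983to89.T4OutputRate

/-! ## §1 Toy data -/

/-- Toy carriers: domains = creation steps (`scale = id`), no tree length (`d ≡ 0`: the printed decay factor
`e^{−κd_j(X)}` is `1`), both runs' backgrounds real numbers, closeness gauge `|U − U′|`, transport the identity. [folklore] -/
abbrev toyC : Carriers where
  Dom := ℕ
  scale := id
  d := fun _ => 0
  d_nonneg := fun _ => le_rfl
  BgA := ℝ
  BgB := ℝ
  gauge := fun U U' => |U - U'|
  gauge_nonneg := fun _ _ => abs_nonneg _
  transport := id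

/-- The linear HISTORY READ-OUT with moduli `Λ`: `Σ_{i<j} Λ j i · g_i` (depends on the couplings `g₀, …, g_{j−1}` only —
the printed-in-words prefix dependence, p. 256 of [Balaban1987RG1]). [folklore] -/
def hist (Λ : ℕ → ℕ → ℝ) (g : ℕ → ℝ) (j : ℕ) : ℝ := ∑ i ∈ range j, Λ j i * g i

/-- Run A's toy functional `a·U + Σ_{i<j} Λ j i·g_i`. [folklore] -/
def EA (a : ℝ) (Λ : ℕ → ℕ → ℝ) : Functional toyC toyC.BgA := fun g (U : ℝ) (j : ℕ) => a * U + hist Λ g j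

/-- Run B's toy functional: run A's shifted by the functional bracket `−C₅·θ^j`. [folklore] -/
def EB (a C₅ θ : ℝ) (Λ : ℕ → ℕ → ℝ) : Functional toyC toyC.BgB :=
  fun g (U : ℝ) (j : ℕ) => a * U + hist Λ g j - C₅ * θ ^ j

/-- Difference of two history read-outs. [folklore] -/
theorem hist_sub (Λ : ℕ → ℕ → ℝ) (g g' : ℕ → ℝ) (j : ℕ) :
    hist Λ g j - hist Λ g' j = ∑ i ∈ range j, Λ j i * (g i - g' i) := by
  simp only [hist, ← sum_sub_distrib, mul_sub]

/-- The history read-out is Lipschitz in the couplings with moduli `Λ` (when `Λ ≥ 0` below the diagonal). [folklore] -/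
theorem abs_hist_sub_le {Λ : ℕ → ℕ → ℝ} (hΛ : ∀ j i, i < j → 0 ≤ Λ j i) (g g' : ℕ → ℝ) (j : ℕ) :
    |hist Λ g j - hist Λ g' j| ≤ ∑ i ∈ range j, Λ j i * |g i - g' i| := by
  rw [hist_sub]
  refine (abs_sum_le_sum_abs _ _).trans (le_of_eq (sum_congr rfl fun i hi => ?_))
  rw [abs_mul, abs_of_nonneg (hΛ j i (mem_range.mp hi))]

/-! ## §2 The hypotheses of `u3_threeBrackets` hold for the toy pair -/

/-- NE9 for run A's toy functional, with the read-out's own moduli, on any window, any κ. [folklore] -/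
theorem ne9_EA {Λ : ℕ → ℕ → ℝ} (hΛ : ∀ j i, i < j → 0 ≤ Λ j i) (a κ : ℝ) (W : Set (ℕ → ℝ)) :
    NE9 (C := toyC) (EA a Λ) W κ Λ := by
  intro g _ g' _ U j
  show |a * U + hist Λ g j - (a * U + hist Λ g' j)| ≤ Real.exp (-(κ * 0)) * ∑ i ∈ range j, Λ j i * |g i - g' i|
  rw [mul_zero, neg_zero, Real.exp_zero, one_mul,
    show a * U + hist Λ g j - (a * U + hist Λ g' j) = hist Λ g j - hist Λ g' j by ring]
  exact abs_hist_sub_le hΛ g g' j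

/-- NE9 for run B's toy functional likewise (the shift does not see the couplings). [folklore] -/
theorem ne9_EB {Λ : ℕ → ℕ → ℝ} (hΛ : ∀ j i, i < j → 0 ≤ Λ j i) (a C₅ θ κ : ℝ) (W : Set (ℕ → ℝ)) :
    NE9 (C := toyC) (EB a C₅ θ Λ) W κ Λ := by
  intro g _ g' _ U j
  show |a * U + hist Λ g j - C₅ * θ ^ j - (a * U + hist Λ g' j - C₅ * θ ^ j)|
      ≤ Real.exp (-(κ * 0)) * ∑ i ∈ range j, Λ j i * |g i - g' i|
  rw [mul_zero, neg_zero, Real.exp_zero, one_mul,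
    show a * U + hist Λ g j - C₅ * θ ^ j - (a * U + hist Λ g' j - C₅ * θ ^ j) = hist Λ g j - hist Λ g' j by ring]
  exact abs_hist_sub_le hΛ g g' j

/-- `LipBackground` for run A's toy functional with the constant family `CU ≡ a` (attained). [folklore] -/
theorem lipBackground_EA {a : ℝ} (ha : 0 ≤ a) (Λ : ℕ → ℕ → ℝ) (κ : ℝ) (W : Set (ℕ → ℝ)) :
    LipBackground (C := toyC) (EA a Λ) W κ (fun _ _ => a) := by
  intro g _ U U' j
  show |a * U + hist Λ g j - (a * U' + hist Λ g j)| ≤ a * Real.exp (-(κ * 0)) * |U - U'|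
  rw [mul_zero, neg_zero, Real.exp_zero, mul_one,
    show a * U + hist Λ g j - (a * U' + hist Λ g j) = a * (U - U') by ring, abs_mul, abs_of_nonneg ha]

/-- NE5 for the toy pair at rate θ with constant C₅ (attained: the difference at fixed arguments IS `C₅θ^j`). [folklore] -/
theorem ne5_EA_EB (a : ℝ) {C₅ θ : ℝ} (hC₅ : 0 ≤ C₅) (hθ : 0 ≤ θ) (Λ : ℕ → ℕ → ℝ) (κ : ℝ) (W : Set (ℕ → ℝ)) :
    NE5 (C := toyC) (EA a Λ) (EB a C₅ θ Λ) W κ θ C₅ := by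
  intro g _ U j
  show |a * U + hist Λ g j - (a * U + hist Λ g j - C₅ * θ ^ j)| ≤ C₅ * θ ^ j * Real.exp (-(κ * 0))
  rw [mul_zero, neg_zero, Real.exp_zero, mul_one,
    show a * U + hist Λ g j - (a * U + hist Λ g j - C₅ * θ ^ j) = C₅ * θ ^ j by ring,
    abs_of_nonneg (mul_nonneg hC₅ (pow_nonneg hθ _))]

/-! ## §3 Sharpness: the three-bracket bound is attained -/

/-- **SHARPNESS OF `u3_threeBrackets`.**  For ordered data — `g^B ≤ g^A` coordinatewise, `U^B ≤ U^A` — the difference of the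
toy runs' scale-j terms EQUALS the three-bracket bound of `T4OutputRate.u3_threeBrackets` with `CU ≡ a`, `δ` the actual
gauge distance, the read-out's moduli and `C₅θ^j`: the right-hand side below is syntactically that theorem's, on `toyC`.
(Its hypotheses hold by `ne9_EA`, `lipBackground_EA`, `ne5_EA_EB`, `le_rfl` for `hδ`, `ha` for `hCU`.) [folklore] -/
theorem u3_threeBrackets_attained {a C₅ θ : ℝ} (ha : 0 ≤ a) (hC₅ : 0 ≤ C₅) (hθ : 0 ≤ θ)
    {Λ : ℕ → ℕ → ℝ} (hΛ : ∀ j i, i < j → 0 ≤ Λ j i)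
    {gA gB : ℕ → ℝ} (hg : ∀ i, gB i ≤ gA i) {UA UB : ℝ} (hU : UB ≤ UA) (κ : ℝ) (j : ℕ) :
    |EA a Λ gA UA j - EB a C₅ θ Λ gB UB j| =
      ((fun _ _ => a) gA (toyC.scale j) * toyC.gauge UA (toyC.transport UB)
        + (∑ i ∈ range (toyC.scale j), Λ (toyC.scale j) i * |gA i - gB i|)
        + C₅ * θ ^ toyC.scale j) * Real.exp (-(κ * toyC.d j)) := by
  show |a * UA + hist Λ gA j - (a * UB + hist Λ gB j - C₅ * θ ^ j)|
      = (a * |UA - UB| + (∑ i ∈ range j, Λ j i * |gA i - gB i|) + C₅ * θ ^ j) * Real.exp (-(κ * 0))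
  have hsum : ∑ i ∈ range j, Λ j i * |gA i - gB i| = ∑ i ∈ range j, Λ j i * (gA i - gB i) :=
    sum_congr rfl fun i _ => by rw [abs_of_nonneg (sub_nonneg.mpr (hg i))]
  have h2 : 0 ≤ ∑ i ∈ range j, Λ j i * (gA i - gB i) :=
    sum_nonneg fun i hi => mul_nonneg (hΛ j i (mem_range.mp hi)) (sub_nonneg.mpr (hg i))
  rw [mul_zero, neg_zero, Real.exp_zero, mul_one, hsum, abs_of_nonneg (sub_nonneg.mpr hU),
    show a * UA + hist Λ gA j - (a * UB + hist Λ gB j - C₅ * θ ^ j)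
      = a * (UA - UB) + (hist Λ gA j - hist Λ gB j) + C₅ * θ ^ j by ring, hist_sub]
  exact abs_of_nonneg (add_nonneg (add_nonneg (mul_nonneg ha (sub_nonneg.mpr hU)) h2)
    (mul_nonneg hC₅ (pow_nonneg hθ _)))

/-- The same, read as: `u3_threeBrackets` applied to the toy data returns an inequality whose two sides are EQUAL.
[folklore] -/
theorem u3_threeBrackets_sharp {a C₅ θ γ : ℝ} (ha : 0 ≤ a) (hC₅ : 0 ≤ C₅) (hθ : 0 ≤ θ)
    {Λ : ℕ → ℕ → ℝ} (hΛ : ∀ j i, i < j → 0 ≤ Λ j i)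
    {gA gB : ℕ → ℝ} (hgA : gA ∈ Window γ) (hgB : gB ∈ Window γ) (hg : ∀ i, gB i ≤ gA i)
    {UA UB : ℝ} (hU : UB ≤ UA) (κ : ℝ) (j : ℕ) :
    (|EA a Λ gA UA j - EB a C₅ θ Λ gB UB j| ≤
      ((fun _ _ => a) gA (toyC.scale j) * toyC.gauge UA (toyC.transport UB)
        + (∑ i ∈ range (toyC.scale j), Λ (toyC.scale j) i * |gA i - gB i|)
        + C₅ * θ ^ toyC.scale j) * Real.exp (-(κ * toyC.d j))) ∧
    |EA a Λ gA UA j - EB a C₅ θ Λ gB UB j| =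
      ((fun _ _ => a) gA (toyC.scale j) * toyC.gauge UA (toyC.transport UB)
        + (∑ i ∈ range (toyC.scale j), Λ (toyC.scale j) i * |gA i - gB i|)
        + C₅ * θ ^ toyC.scale j) * Real.exp (-(κ * toyC.d j)) :=
  ⟨u3_threeBrackets (C := toyC) (ne9_EA hΛ a κ (Window γ)) (lipBackground_EA ha Λ κ (Window γ))
      (ne5_EA_EB a hC₅ hθ Λ κ (Window γ)) hgA hgB le_rfl j ha,
    u3_threeBrackets_attained ha hC₅ hθ hΛ hg hU κ j⟩

/-! ## §4 GAPS G-t4-U3-6 made kernel: fading memory (in the AGE) is load-bearing for the target shape -/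

/-- BIRTH-INDEXED ("ultraviolet-heavy") moduli `Λ j i = ℓ·θ^i`: summable along every row (`≤ ℓ(1−θ)⁻¹`), bounded by `ℓ`
(for `θ ≤ 1`), decaying in the BIRTH step `i` — and CONSTANT IN THE AGE `j − i`. [folklore] -/
def uvMod (ℓ θ : ℝ) : ℕ → ℕ → ℝ := fun _ i => ℓ * θ ^ i

/-- AGE-INDEXED moduli `Λ j i = ℓ·ω^{j−i}` (the `FadingMemory` regime; §5). [folklore] -/
def ageMod (ℓ ω : ℝ) : ℕ → ℕ → ℝ := fun j i => ℓ * ω ^ (j - i)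

/-- Run B's toy coupling sequence: constant `γ/2`. [folklore] -/
def gLo (γ : ℝ) : ℕ → ℝ := fun _ => γ / 2

/-- Run A's toy coupling sequence: `γ/2 + (γ/2)·θ^i` — node U2's output shape at rate θ, attained. [folklore] -/
def gHi (γ θ : ℝ) : ℕ → ℝ := fun i => γ / 2 + γ / 2 * θ ^ i

/-- A one-coordinate dip of `gLo` at the birth step 0 (the probe of `moduli_floor`). [folklore] -/
def gDip (γ : ℝ) : ℕ → ℝ := fun i => if i = 0 then γ / 4 else γ / 2

/-- The birth-indexed moduli, evaluated. [folklore] -/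
theorem uvMod_apply (ℓ θ : ℝ) (j i : ℕ) : uvMod ℓ θ j i = ℓ * θ ^ i := rfl

/-- The birth-indexed moduli are nonnegative. [folklore] -/
theorem uvMod_nonneg {ℓ θ : ℝ} (hℓ : 0 ≤ ℓ) (hθ : 0 ≤ θ) (j i : ℕ) : 0 ≤ uvMod ℓ θ j i :=
  mul_nonneg hℓ (pow_nonneg hθ i)

/-- The birth-indexed moduli are nonnegative below the diagonal (the binder shape of `ne9_EA`). [folklore] -/
theorem uvMod_nonneg' {ℓ θ : ℝ} (hℓ : 0 ≤ ℓ) (hθ : 0 ≤ θ) : ∀ j i : ℕ, i < j → 0 ≤ uvMod ℓ θ j i :=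
  fun j i _ => uvMod_nonneg hℓ hθ j i

/-- Run B's toy couplings, evaluated. [folklore] -/
theorem gLo_apply (γ : ℝ) (i : ℕ) : gLo γ i = γ / 2 := rfl

/-- The dipped sequence at the birth step 0. [folklore] -/
theorem gDip_zero (γ : ℝ) : gDip γ 0 = γ / 4 := by simp [gDip]

/-- The dipped sequence away from the birth step 0. [folklore] -/
theorem gDip_of_ne_zero (γ : ℝ) {i : ℕ} (hi : i ≠ 0) : gDip γ i = γ / 2 := by simp [gDip, hi]

/-- Run B's toy couplings lie in the window `]0, γ]`. [folklore] -/
theorem gLo_mem {γ : ℝ} (hγ : 0 < γ) : gLo γ ∈ Window γ :=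
  mem_window.mpr fun _ => ⟨half_pos hγ, half_le_self hγ.le⟩

/-- Run A's toy couplings lie in the window `]0, γ]` (for `0 ≤ θ ≤ 1`). [folklore] -/
theorem gHi_mem {γ θ : ℝ} (hγ : 0 < γ) (hθ0 : 0 ≤ θ) (hθ1 : θ ≤ 1) : gHi γ θ ∈ Window γ :=
  mem_window.mpr fun i => by
    have h1 : 0 ≤ γ / 2 * θ ^ i := mul_nonneg (half_pos hγ).le (pow_nonneg hθ0 i)
    have h2 : γ / 2 * θ ^ i ≤ γ / 2 := mul_le_of_le_one_right (half_pos hγ).le (pow_le_one₀ hθ0 hθ1)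
    show 0 < γ / 2 + γ / 2 * θ ^ i ∧ γ / 2 + γ / 2 * θ ^ i ≤ γ
    constructor <;> linarith

/-- The dipped sequence lies in the window `]0, γ]`. [folklore] -/
theorem gDip_mem {γ : ℝ} (hγ : 0 < γ) : gDip γ ∈ Window γ :=
  mem_window.mpr fun i => by
    show 0 < (if i = 0 then γ / 4 else γ / 2) ∧ (if i = 0 then γ / 4 else γ / 2) ≤ γ
    split_ifs <;> constructor <;> linarith

/-- Node U2's output shape at rate θ holds for the toy couplings, WITH EQUALITY: `|g^A_i − g^B_i| = (γ/2)·θ^i`. [folklore] -/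
theorem disc_eq {γ θ : ℝ} (hγ : 0 ≤ γ) (hθ : 0 ≤ θ) (i : ℕ) : |gHi γ θ i - gLo γ i| = γ / 2 * θ ^ i := by
  show |γ / 2 + γ / 2 * θ ^ i - γ / 2| = γ / 2 * θ ^ i
  rw [show γ / 2 + γ / 2 * θ ^ i - γ / 2 = γ / 2 * θ ^ i by ring,
    abs_of_nonneg (mul_nonneg (by linarith) (pow_nonneg hθ i))]

/-- The printed uniform bound (1.18)/(0.25) — `DecayBound` — HOLDS for run A's birth-indexed toy functional on the window
`]0, γ]`, with `E₀ = ℓγ(1−θ)⁻¹`. [folklore] -/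
theorem decayBound_EA_uv {ℓ θ γ : ℝ} (hℓ : 0 ≤ ℓ) (hθ0 : 0 ≤ θ) (hθ1 : θ < 1) (hγ : 0 ≤ γ) (κ : ℝ) :
    DecayBound (C := toyC) (EA 0 (uvMod ℓ θ)) (Window γ) (ℓ * γ * (1 - θ)⁻¹) κ := by
  intro g hg U j
  show |0 * U + ∑ i ∈ range j, uvMod ℓ θ j i * g i| ≤ ℓ * γ * (1 - θ)⁻¹ * Real.exp (-(κ * 0))
  rw [zero_mul, zero_add, mul_zero, neg_zero, Real.exp_zero, mul_one]
  have hgi := mem_window.mp hg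
  calc |∑ i ∈ range j, uvMod ℓ θ j i * g i| ≤ ∑ i ∈ range j, |uvMod ℓ θ j i * g i| := abs_sum_le_sum_abs _ _
    _ ≤ ∑ i ∈ range j, ℓ * γ * θ ^ i := sum_le_sum fun i _ => by
        rw [abs_mul, abs_of_nonneg (uvMod_nonneg hℓ hθ0 j i), abs_of_pos (hgi i).1,
          show uvMod ℓ θ j i = ℓ * θ ^ i from rfl]
        nlinarith [mul_nonneg hℓ (pow_nonneg hθ0 i), (hgi i).2]
    _ = ℓ * γ * ∑ i ∈ range j, θ ^ i := by rw [mul_sum]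
    _ ≤ ℓ * γ * (1 - θ)⁻¹ := mul_le_mul_of_nonneg_left
        (sum_le_hasSum _ (fun n _ => pow_nonneg hθ0 n) (hasSum_geometric_of_lt_one hθ0 hθ1)) (mul_nonneg hℓ hγ)

/-- … and for run B's, with `E₀ = ℓγ(1−θ)⁻¹ + C₅`. [folklore] -/
theorem decayBound_EB_uv {ℓ θ γ C₅ : ℝ} (hℓ : 0 ≤ ℓ) (hθ0 : 0 ≤ θ) (hθ1 : θ < 1) (hγ : 0 ≤ γ) (hC₅ : 0 ≤ C₅) (κ : ℝ) :
    DecayBound (C := toyC) (EB 0 C₅ θ (uvMod ℓ θ)) (Window γ) (ℓ * γ * (1 - θ)⁻¹ + C₅) κ := by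
  intro g hg U j
  have hA := decayBound_EA_uv hℓ hθ0 hθ1 hγ κ g hg U j
  change |0 * U + hist (uvMod ℓ θ) g j| ≤ ℓ * γ * (1 - θ)⁻¹ * Real.exp (-(κ * 0)) at hA
  show |0 * U + hist (uvMod ℓ θ) g j - C₅ * θ ^ j| ≤ (ℓ * γ * (1 - θ)⁻¹ + C₅) * Real.exp (-(κ * 0))
  rw [mul_zero, neg_zero, Real.exp_zero, mul_one] at hA ⊢
  have hθj : C₅ * θ ^ j ≤ C₅ := mul_le_of_le_one_right hC₅ (pow_le_one₀ hθ0 hθ1.le)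
  calc |0 * U + hist (uvMod ℓ θ) g j - C₅ * θ ^ j| ≤ |0 * U + hist (uvMod ℓ θ) g j| + |C₅ * θ ^ j| := abs_sub _ _
    _ ≤ ℓ * γ * (1 - θ)⁻¹ + C₅ := by
        rw [abs_of_nonneg (mul_nonneg hC₅ (pow_nonneg hθ0 j))]
        exact add_le_add hA hθj

/-- The difference of the two toy runs' scale-j terms at a common background, IN CLOSED FORM:
`ℓ(γ/2)·Σ_{i<j} θ^i·θ^i + C₅θ^j` — the coupling bracket with birth-indexed moduli plus the functional bracket. [folklore] -/
theorem runDiff_eq (ℓ θ γ C₅ U : ℝ) (j : ℕ) :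
    EA 0 (uvMod ℓ θ) (gHi γ θ) U j - EB 0 C₅ θ (uvMod ℓ θ) (gLo γ) U j
      = ℓ * (γ / 2) * (∑ i ∈ range j, θ ^ i * θ ^ i) + C₅ * θ ^ j := by
  show 0 * U + hist (uvMod ℓ θ) (gHi γ θ) j - (0 * U + hist (uvMod ℓ θ) (gLo γ) j - C₅ * θ ^ j) = _
  have h := hist_sub (uvMod ℓ θ) (gHi γ θ) (gLo γ) j
  have h2 : ∑ i ∈ range j, uvMod ℓ θ j i * (gHi γ θ i - gLo γ i) = ℓ * (γ / 2) * ∑ i ∈ range j, θ ^ i * θ ^ i := by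
    rw [mul_sum]
    refine sum_congr rfl fun i _ => ?_
    simp only [uvMod, gHi, gLo]
    ring
  linear_combination h + h2

/-- The coupling bracket of node U3 for the toy data, in closed form: `Σ_{i<j} ℓθ^i·|g^A_i − g^B_i| = ℓ(γ/2)·Σ_{i<j}θ^{2i}`
— uniformly BOUNDED in j (by `ℓ(γ/2)(1−θ²)⁻¹`) but NOT decaying. [folklore] -/
theorem couplingBracket_eq {ℓ θ γ : ℝ} (hγ : 0 ≤ γ) (hθ : 0 ≤ θ) (j : ℕ) :
    ∑ i ∈ range j, uvMod ℓ θ j i * |gHi γ θ i - gLo γ i| = ℓ * (γ / 2) * ∑ i ∈ range j, θ ^ i * θ ^ i := by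
  rw [mul_sum]
  refine sum_congr rfl fun i _ => ?_
  rw [disc_eq hγ hθ, show uvMod ℓ θ j i = ℓ * θ ^ i from rfl]
  ring

/-- The sum `Σ_{i<j} θ^i·θ^i` is at least its birth-step-0 term `1` once `j ≥ 1`. [folklore] -/
theorem one_le_sum_sq {θ : ℝ} (hθ : 0 ≤ θ) {j : ℕ} (hj : 1 ≤ j) : 1 ≤ ∑ i ∈ range j, θ ^ i * θ ^ i := by
  have h := single_le_sum (f := fun i => θ ^ i * θ ^ i) (fun i _ => mul_nonneg (pow_nonneg hθ i) (pow_nonneg hθ i))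
    (mem_range.mpr (by omega : 0 < j))
  simpa using h

/-- LOWER BOUND: at every creation step `j ≥ 1` the two toy runs' terms differ by at least `ℓγ/2`, uniformly in j.
[folklore] -/
theorem runDiff_ge {ℓ θ γ C₅ : ℝ} (hℓ : 0 ≤ ℓ) (hθ : 0 ≤ θ) (hγ : 0 ≤ γ) (hC₅ : 0 ≤ C₅) (U : ℝ) {j : ℕ} (hj : 1 ≤ j) :
    ℓ * (γ / 2) ≤ EA 0 (uvMod ℓ θ) (gHi γ θ) U j - EB 0 C₅ θ (uvMod ℓ θ) (gLo γ) U j := by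
  rw [runDiff_eq]
  have h1 := one_le_sum_sq hθ hj
  have h0 : 0 ≤ ℓ * (γ / 2) := mul_nonneg hℓ (by linarith)
  nlinarith [mul_le_mul_of_nonneg_left h1 h0, mul_nonneg hC₅ (pow_nonneg hθ j)]

/-- **THE CARVER'S TARGET SHAPE FAILS** for the toy pair: for NO constant `E₀′` and NO rate `ν ∈ [0, 1)` is
`|E^{(j),A} − E^{(j),B}| ≤ E₀′·ν^j·e^{−κd_j}` for all creation steps — the conclusion shape of `T4OutputRate.u3_geometric`
(there `E₀′ = a + b + C₅`, `ν = θ`). [folklore] -/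
theorem u3Target_fails {ℓ θ γ C₅ : ℝ} (hℓ : 0 < ℓ) (hθ : 0 ≤ θ) (hγ : 0 < γ) (hC₅ : 0 ≤ C₅) (κ U E₀' : ℝ)
    {ν : ℝ} (hν0 : 0 ≤ ν) (hν1 : ν < 1) :
    ¬ ∀ j : ℕ, |EA 0 (uvMod ℓ θ) (gHi γ θ) U j - EB 0 C₅ θ (uvMod ℓ θ) (gLo γ) U j|
        ≤ E₀' * ν ^ toyC.scale j * Real.exp (-(κ * toyC.d j)) := by
  intro h
  have hb : ∀ j : ℕ, 1 ≤ j → ℓ * (γ / 2) ≤ E₀' * ν ^ j := fun j hj => by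
    have hjb := h j
    change |EA 0 (uvMod ℓ θ) (gHi γ θ) U j - EB 0 C₅ θ (uvMod ℓ θ) (gLo γ) U j| ≤ E₀' * ν ^ j * Real.exp (-(κ * 0))
      at hjb
    rw [mul_zero, neg_zero, Real.exp_zero, mul_one] at hjb
    exact (runDiff_ge hℓ.le hθ hγ.le hC₅ U hj).trans ((le_abs_self _).trans hjb)
  have hpos : 0 < ℓ * (γ / 2) := mul_pos hℓ (half_pos hγ)
  have hE : 0 < E₀' := by
    by_contra hE
    have hE' : E₀' ≤ 0 := le_of_not_gt hE
    have h1 := hb 1 le_rfl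
    nlinarith [pow_nonneg hν0 1]
  obtain ⟨n, hn⟩ := exists_pow_lt_of_lt_one (div_pos hpos hE) hν1
  have h2 := hb (n + 1) (by omega)
  have h3 : ν ^ (n + 1) ≤ ν ^ n := by
    rw [pow_succ]
    exact mul_le_of_le_one_right (pow_nonneg hν0 n) hν1.le
  have h4 : ν ^ n * E₀' < ℓ * (γ / 2) := (lt_div_iff₀ hE).mp hn
  nlinarith [mul_le_mul_of_nonneg_left h3 hE.le]

/-- The `hb` input of `T4OutputRate.u3_geometric` (coupling bracket `≤ b·θ^j`) FAILS for every `b` on the toy data, as soon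
as `θ < 1`, although node U2's output shape holds at rate θ. [folklore] -/
theorem couplingBracket_not_atRate {ℓ θ γ : ℝ} (hℓ : 0 < ℓ) (hθ0 : 0 ≤ θ) (hθ1 : θ < 1) (hγ : 0 < γ) (b : ℝ) :
    ¬ ∀ j : ℕ, (∑ i ∈ range (toyC.scale j), uvMod ℓ θ (toyC.scale j) i * |gHi γ θ i - gLo γ i|)
        ≤ b * θ ^ toyC.scale j := by
  intro h
  have hb : ∀ j : ℕ, 1 ≤ j → ℓ * (γ / 2) ≤ b * θ ^ j := fun j hj => by
    have hjb := h j
    change (∑ i ∈ range j, uvMod ℓ θ j i * |gHi γ θ i - gLo γ i|) ≤ b * θ ^ j at hjb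
    rw [couplingBracket_eq hγ.le hθ0] at hjb
    have h0 : 0 ≤ ℓ * (γ / 2) := mul_nonneg hℓ.le (half_pos hγ).le
    nlinarith [mul_le_mul_of_nonneg_left (one_le_sum_sq hθ0 hj) h0]
  have hpos : 0 < ℓ * (γ / 2) := mul_pos hℓ (half_pos hγ)
  have hB : 0 < b := by
    by_contra hB
    have hB' : b ≤ 0 := le_of_not_gt hB
    have h1 := hb 1 le_rfl
    nlinarith [pow_nonneg hθ0 1]
  obtain ⟨n, hn⟩ := exists_pow_lt_of_lt_one (div_pos hpos hB) hθ1
  have h2 := hb (n + 1) (by omega)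
  have h3 : θ ^ (n + 1) ≤ θ ^ n := by
    rw [pow_succ]
    exact mul_le_of_le_one_right (pow_nonneg hθ0 n) hθ1.le
  have h4 : θ ^ n * b < ℓ * (γ / 2) := (lt_div_iff₀ hB).mp hn
  nlinarith [mul_le_mul_of_nonneg_left h3 hB.le]

/-- **MODULI FLOOR.**  ANY moduli family `Λ′` validating NE9 for run A's birth-indexed toy functional on the window `]0, γ]`
has `Λ′ j 0 ≥ ℓ` at every creation step `j ≥ 1`: the influence of the birth-step-0 coupling never fades (probe: `gLo`
against its dip `gDip` at coordinate 0). [folklore] -/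
theorem moduli_floor {ℓ θ γ κ : ℝ} (hγ : 0 < γ) {Λ' : ℕ → ℕ → ℝ}
    (h9 : NE9 (C := toyC) (EA 0 (uvMod ℓ θ)) (Window γ) κ Λ') {j : ℕ} (hj : 1 ≤ j) : ℓ ≤ Λ' j 0 := by
  have h := h9 (gLo γ) (gLo_mem hγ) (gDip γ) (gDip_mem hγ) 0 j
  change |0 * (0 : ℝ) + hist (uvMod ℓ θ) (gLo γ) j - (0 * 0 + hist (uvMod ℓ θ) (gDip γ) j)|
      ≤ Real.exp (-(κ * 0)) * ∑ i ∈ range j, Λ' j i * |gLo γ i - gDip γ i| at h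
  have h0j : 0 ∈ range j := mem_range.mpr (by omega)
  have hoff : ∀ i ∈ range j, i ≠ 0 → gLo γ i - gDip γ i = 0 := fun i _ hi => by
    rw [gLo_apply, gDip_of_ne_zero γ hi, sub_self]
  have h00 : gLo γ 0 - gDip γ 0 = γ / 4 := by
    rw [gLo_apply, gDip_zero]
    ring
  have lhs : (0 : ℝ) * 0 + hist (uvMod ℓ θ) (gLo γ) j - (0 * 0 + hist (uvMod ℓ θ) (gDip γ) j) = ℓ * (γ / 4) := by
    rw [show (0 : ℝ) * 0 + hist (uvMod ℓ θ) (gLo γ) j - (0 * 0 + hist (uvMod ℓ θ) (gDip γ) j)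
        = hist (uvMod ℓ θ) (gLo γ) j - hist (uvMod ℓ θ) (gDip γ) j by ring, hist_sub,
      sum_eq_single_of_mem 0 h0j fun i hi hi0 => by rw [hoff i hi hi0, mul_zero], h00, uvMod_apply, pow_zero,
      mul_one]
  have rhs : Real.exp (-(κ * 0)) * ∑ i ∈ range j, Λ' j i * |gLo γ i - gDip γ i| = Λ' j 0 * (γ / 4) := by
    rw [mul_zero, neg_zero, Real.exp_zero, one_mul,
      sum_eq_single_of_mem 0 h0j fun i hi hi0 => by rw [hoff i hi hi0, abs_zero, mul_zero], h00,
      abs_of_nonneg (by linarith)]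
  rw [lhs, rhs] at h
  exact le_of_mul_le_mul_right ((le_abs_self _).trans h) (by linarith)

/-- **NO FADING MODULI.**  Consequently NO moduli family validating NE9 for run A's toy functional has `FadingMemory C₉ ω`
with a rate `ω < 1`, whatever the constant `C₉`: the hypothesis shape `FadingMemory` EXCLUDES this inhabitant of all the
other displayed hypotheses of node U3. [folklore] -/
theorem not_fadingMemory_of_ne9 {ℓ θ γ κ : ℝ} (hℓ : 0 < ℓ) (hγ : 0 < γ) {Λ' : ℕ → ℕ → ℝ}
    (h9 : NE9 (C := toyC) (EA 0 (uvMod ℓ θ)) (Window γ) κ Λ') {ω : ℝ} (hω : ω < 1) (C₉ : ℝ) :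
    ¬ FadingMemory C₉ ω Λ' := by
  intro hF
  have hC9 : 0 ≤ C₉ := by
    have h00 := hF 0 0 le_rfl
    have := h00.1.trans h00.2
    simpa using this
  have floor : ∀ n : ℕ, ℓ ≤ C₉ * ω ^ (n + 1) := fun n => by
    have h1 := moduli_floor hγ h9 (j := n + 1) (by omega)
    have h2 := (hF (n + 1) 0 (Nat.zero_le _)).2
    rw [Nat.sub_zero] at h2
    exact h1.trans h2
  rcases lt_or_ge ω 0 with hωneg | hω0
  · have h1 := floor 0
    rw [zero_add, pow_one] at h1
    nlinarith
  · obtain ⟨n, hn⟩ := exists_pow_lt_of_lt_one (div_pos hℓ (by linarith : (0 : ℝ) < C₉ + 1)) hω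
    have h1 := floor n
    have h2 : ω ^ (n + 1) ≤ ω ^ n := by
      rw [pow_succ]
      exact mul_le_of_le_one_right (pow_nonneg hω0 n) hω.le
    have h3 : ω ^ n * (C₉ + 1) < ℓ := (lt_div_iff₀ (by linarith)).mp hn
    nlinarith [mul_le_mul_of_nonneg_left h2 hC9, pow_nonneg hω0 n]

/-- The birth-indexed moduli themselves have no fading memory either (special case, direct). [folklore] -/
theorem not_fadingMemory_uvMod {ℓ θ : ℝ} (hℓ : 0 < ℓ) (hθ : 0 ≤ θ) {ω : ℝ} (hω : ω < 1) (C₉ : ℝ) :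
    ¬ FadingMemory C₉ ω (uvMod ℓ θ) :=
  not_fadingMemory_of_ne9 (γ := 1) (κ := 0) hℓ one_pos (ne9_EA (uvMod_nonneg' hℓ.le hθ) 0 0 (Window 1)) hω C₉

/-- **GAPS G-t4-U3-6, KERNEL FORM (packaged).**  For every `ℓ > 0`, `0 ≤ θ < 1`, `γ > 0`, `C₅ ≥ 0`, every κ and every
common background `U`, the toy pair `EA 0 (uvMod ℓ θ)` / `EB 0 C₅ θ (uvMod ℓ θ)` with couplings `gHi γ θ` / `gLo γ` meets:
the printed uniform bound `DecayBound` for both runs; NE9 for run A (and run B); `LipBackground` (constant 0); NE5 at rate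
θ; both coupling sequences in the window with node U2's discrepancy shape `(γ/2)θ^i`; exact backgrounds (gauge distance
0) — i.e. every hypothesis of `u3_threeBrackets`, and of `u3_geometric` except `hb` — while NO NE9-moduli family of run A
has fading memory at any rate `ω < 1`, and the carver's target shape fails for every constant and every rate `ν ∈ [0,1)`.
Hence, among the displayed hypothesis shapes of node U3, `FadingMemory` (decay in the AGE `j − i`) is LOAD-BEARING for the
target `E₀′θ^j e^{−κd_j(X)}`; summability / boundedness of the moduli and the printed (1.18) are not substitutes. [folklore] -/
theorem fadingMemory_loadBearing {ℓ θ γ C₅ : ℝ} (hℓ : 0 < ℓ) (hθ0 : 0 ≤ θ) (hθ1 : θ < 1) (hγ : 0 < γ) (hC₅ : 0 ≤ C₅)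
    (κ U : ℝ) :
    DecayBound (C := toyC) (EA 0 (uvMod ℓ θ)) (Window γ) (ℓ * γ * (1 - θ)⁻¹) κ ∧
    DecayBound (C := toyC) (EB 0 C₅ θ (uvMod ℓ θ)) (Window γ) (ℓ * γ * (1 - θ)⁻¹ + C₅) κ ∧
    NE9 (C := toyC) (EA 0 (uvMod ℓ θ)) (Window γ) κ (uvMod ℓ θ) ∧
    NE9 (C := toyC) (EB 0 C₅ θ (uvMod ℓ θ)) (Window γ) κ (uvMod ℓ θ) ∧
    LipBackground (C := toyC) (EA 0 (uvMod ℓ θ)) (Window γ) κ (fun _ _ => 0) ∧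
    NE5 (C := toyC) (EA 0 (uvMod ℓ θ)) (EB 0 C₅ θ (uvMod ℓ θ)) (Window γ) κ θ C₅ ∧
    gHi γ θ ∈ Window γ ∧ gLo γ ∈ Window γ ∧
    (∀ i, |gHi γ θ i - gLo γ i| ≤ γ / 2 * θ ^ i) ∧
    toyC.gauge U (toyC.transport U) ≤ 0 ∧
    (∀ (Λ' : ℕ → ℕ → ℝ) (C₉ ω : ℝ), NE9 (C := toyC) (EA 0 (uvMod ℓ θ)) (Window γ) κ Λ' → ω < 1 →
      ¬ FadingMemory C₉ ω Λ') ∧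
    ∀ (E₀' ν : ℝ), 0 ≤ ν → ν < 1 →
      ¬ ∀ j : ℕ, |EA 0 (uvMod ℓ θ) (gHi γ θ) U j - EB 0 C₅ θ (uvMod ℓ θ) (gLo γ) U j|
          ≤ E₀' * ν ^ toyC.scale j * Real.exp (-(κ * toyC.d j)) :=
  ⟨decayBound_EA_uv hℓ.le hθ0 hθ1 hγ.le κ,
    decayBound_EB_uv hℓ.le hθ0 hθ1 hγ.le hC₅ κ,
    ne9_EA (uvMod_nonneg' hℓ.le hθ0) 0 κ (Window γ),
    ne9_EB (uvMod_nonneg' hℓ.le hθ0) 0 C₅ θ κ (Window γ),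
    lipBackground_EA le_rfl (uvMod ℓ θ) κ (Window γ),
    ne5_EA_EB 0 hC₅ hθ0 (uvMod ℓ θ) κ (Window γ),
    gHi_mem hγ hθ0 hθ1.le, gLo_mem hγ,
    fun i => (disc_eq hγ.le hθ0 i).le,
    by show |U - U| ≤ (0 : ℝ); simp,
    fun Λ' C₉ ω h9 hω => not_fadingMemory_of_ne9 hℓ hγ h9 hω C₉,
    fun E₀' ν hν0 hν1 => u3Target_fails hℓ hθ0 hγ hC₅ κ U E₀' hν0 hν1⟩

/-! ## §5 Contrast (one line): age-indexed moduli fade -/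

/-- AGE-indexed moduli `ℓ·ω^{j−i}` have `FadingMemory ℓ ω` — the regime in which the tree's
`T4TowerRateComposition.historySum_le_rate` / `historySum_le_rate_of_lt` (unit t4-ne7-p1; not imported here) turn node U2's
discrepancy shape `D·θ^i` into the coupling bracket at rate `max(ω, θ) < ν`, i.e. supply the `hb` of `u3_geometric`.
[folklore] -/
theorem fadingMemory_ageMod {ℓ ω : ℝ} (hℓ : 0 ≤ ℓ) (hω : 0 ≤ ω) : FadingMemory ℓ ω (ageMod ℓ ω) :=
  fun _ _ _ => ⟨mul_nonneg hℓ (pow_nonneg hω _), le_rfl⟩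


/-! ## §6 (v1.1) Equal rates `ω = θ`: the linear loss of the coupling bracket is attained -/

/-- The age-indexed moduli, evaluated. [folklore] -/
theorem ageMod_apply (ℓ ω : ℝ) (j i : ℕ) : ageMod ℓ ω j i = ℓ * ω ^ (j - i) := rfl

/-- Nonnegativity of the age-indexed moduli. [folklore] -/
theorem ageMod_nonneg {ℓ ω : ℝ} (hℓ : 0 ≤ ℓ) (hω : 0 ≤ ω) (j i : ℕ) : 0 ≤ ageMod ℓ ω j i :=
  mul_nonneg hℓ (pow_nonneg hω _)

/-- … in the binder form `ne9_EA` wants. [folklore] -/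
theorem ageMod_nonneg' {ℓ ω : ℝ} (hℓ : 0 ≤ ℓ) (hω : 0 ≤ ω) : ∀ j i : ℕ, i < j → 0 ≤ ageMod ℓ ω j i :=
  fun j i _ => ageMod_nonneg hℓ hω j i

/-- TERMWISE, AT EQUAL RATES: age modulus × node U2's birth-step-i discrepancy `= ℓ(γ/2)·θ^j`, the SAME number for every
birth step `i < j` (`θ^{j−i}·θ^i = θ^j`). [folklore] -/
theorem ageTerm_abs_eq {ℓ θ γ : ℝ} (hγ : 0 ≤ γ) (hθ : 0 ≤ θ) {j i : ℕ} (hij : i < j) :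
    ageMod ℓ θ j i * |gHi γ θ i - gLo γ i| = ℓ * (γ / 2) * θ ^ j := by
  have hpow : θ ^ (j - i) * θ ^ i = θ ^ j := by rw [← pow_add, Nat.sub_add_cancel hij.le]
  rw [disc_eq hγ hθ, ageMod_apply, ← hpow]
  ring

/-- The signed version (no sign hypotheses needed: `gHi − gLo = (γ/2)θ^i` identically). [folklore] -/
theorem ageTerm_eq (ℓ θ γ : ℝ) {j i : ℕ} (hij : i < j) :
    ageMod ℓ θ j i * (gHi γ θ i - gLo γ i) = ℓ * (γ / 2) * θ ^ j := by
  have hpow : θ ^ (j - i) * θ ^ i = θ ^ j := by rw [← pow_add, Nat.sub_add_cancel hij.le]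
  have e1 : gHi γ θ i - gLo γ i = γ / 2 * θ ^ i := by simp only [gHi, gLo]; ring
  rw [e1, ageMod_apply, ← hpow]
  ring

/-- **THE COUPLING BRACKET IN CLOSED FORM AT EQUAL RATES**: `Σ_{i<j} ℓθ^{j−i}·|g^A_i − g^B_i| = ℓ(γ/2)·j·θ^j` — geometric
AT THE NE5 RATE up to a factor LINEAR in the creation step. [folklore] -/
theorem couplingBracket_age_eq {ℓ θ γ : ℝ} (hγ : 0 ≤ γ) (hθ : 0 ≤ θ) (j : ℕ) :
    ∑ i ∈ range j, ageMod ℓ θ j i * |gHi γ θ i - gLo γ i| = ℓ * (γ / 2) * (j : ℝ) * θ ^ j := by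
  have h : ∀ i ∈ range j, ageMod ℓ θ j i * |gHi γ θ i - gLo γ i| = ℓ * (γ / 2) * θ ^ j :=
    fun i hi => ageTerm_abs_eq hγ hθ (mem_range.mp hi)
  rw [sum_congr rfl h, sum_const, card_range, nsmul_eq_mul]
  ring

/-- The instance `C₉ = ℓ`, `D = γ/2`, `ω = θ` of the tree's `T4TowerRateComposition.historySum_le_maxRate` (unit t4-ne7-p1;
bound `C₉·D·j·(max ω θ)^j`; not imported) holds here WITH EQUALITY — stated over `max θ θ` to match that lemma's right-hand
side literally: the linear factor `j` of the equal-rate case is attained, not an artefact of the proof. [folklore] -/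
theorem maxRate_bound_attained {ℓ θ γ : ℝ} (hγ : 0 ≤ γ) (hθ : 0 ≤ θ) (j : ℕ) :
    ∑ i ∈ range j, ageMod ℓ θ j i * |gHi γ θ i - gLo γ i| = ℓ * (γ / 2) * (j : ℝ) * (max θ θ) ^ j := by
  rw [max_self, couplingBracket_age_eq hγ hθ]

/-- **NO j-UNIFORM CONSTANT AT THE NE5 RATE.**  For `ℓ, θ, γ > 0` there is NO `b` with
`Σ_{i<j} Λ j i·|g^A_i − g^B_i| ≤ b·θ^j` for all creation steps: the `hb` input of `T4OutputRate.u3_geometric` at rate θ is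
unavailable from fading memory AT THE SAME RATE `ω = θ` (contrast: available at any rate `ν > θ` by the tree's
`historySum_le_rate_of_lt`, and at rate θ when `ω < θ` by `historySum_le_rate`; neither re-proved here). [folklore] -/
theorem couplingBracket_age_not_atRate {ℓ θ γ : ℝ} (hℓ : 0 < ℓ) (hθ : 0 < θ) (hγ : 0 < γ) (b : ℝ) :
    ¬ ∀ j : ℕ, ∑ i ∈ range j, ageMod ℓ θ j i * |gHi γ θ i - gLo γ i| ≤ b * θ ^ j := by
  intro h
  have hc : 0 < ℓ * (γ / 2) := mul_pos hℓ (half_pos hγ)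
  obtain ⟨n, hn⟩ := exists_nat_gt (b / (ℓ * (γ / 2)))
  have hj := h n
  rw [couplingBracket_age_eq hγ.le hθ.le] at hj
  have h1 : ℓ * (γ / 2) * (n : ℝ) ≤ b := le_of_mul_le_mul_right hj (pow_pos hθ n)
  have h2 : b < (n : ℝ) * (ℓ * (γ / 2)) := (div_lt_iff₀ hc).mp hn
  have h3 : (n : ℝ) * (ℓ * (γ / 2)) = ℓ * (γ / 2) * (n : ℝ) := by ring
  linarith

/-- The difference of the two toy runs' scale-j terms at a common background, at equal rates, IN CLOSED FORM:
`(ℓ(γ/2)·j + C₅)·θ^j` — coupling bracket `ℓ(γ/2)·j·θ^j` plus functional bracket `C₅θ^j`. [folklore] -/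
theorem runDiff_age_eq (ℓ θ γ C₅ U : ℝ) (j : ℕ) :
    EA 0 (ageMod ℓ θ) (gHi γ θ) U j - EB 0 C₅ θ (ageMod ℓ θ) (gLo γ) U j
      = ℓ * (γ / 2) * (j : ℝ) * θ ^ j + C₅ * θ ^ j := by
  show 0 * U + hist (ageMod ℓ θ) (gHi γ θ) j - (0 * U + hist (ageMod ℓ θ) (gLo γ) j - C₅ * θ ^ j) = _
  have h := hist_sub (ageMod ℓ θ) (gHi γ θ) (gLo γ) j
  have h3 : ∀ i ∈ range j, ageMod ℓ θ j i * (gHi γ θ i - gLo γ i) = ℓ * (γ / 2) * θ ^ j :=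
    fun i hi => ageTerm_eq ℓ θ γ (mem_range.mp hi)
  have h2 : ∑ i ∈ range j, ageMod ℓ θ j i * (gHi γ θ i - gLo γ i) = ℓ * (γ / 2) * (j : ℝ) * θ ^ j := by
    rw [sum_congr rfl h3, sum_const, card_range, nsmul_eq_mul]
    ring
  linear_combination h + h2

/-- The printed uniform bound `DecayBound` HOLDS for run A's age-indexed toy functional on the window `]0, γ]`, with
`E₀ = ℓγ(1−θ)⁻¹` (via the tree's `T4OutputRate.historySum_le_of_fadingMemory` against the zero sequence; no sign hypothesis on
γ is needed — an empty window gives a vacuous bound). [folklore] -/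
theorem decayBound_EA_age {ℓ θ : ℝ} (hℓ : 0 ≤ ℓ) (hθ0 : 0 ≤ θ) (hθ1 : θ < 1) (γ κ : ℝ) :
    DecayBound (C := toyC) (EA 0 (ageMod ℓ θ)) (Window γ) (ℓ * γ * (1 - θ)⁻¹) κ := by
  intro g hg U j
  show |0 * U + ∑ i ∈ range j, ageMod ℓ θ j i * g i| ≤ ℓ * γ * (1 - θ)⁻¹ * Real.exp (-(κ * 0))
  rw [zero_mul, zero_add, mul_zero, neg_zero, Real.exp_zero, mul_one]
  have hgi := mem_window.mp hg
  have hD : ∀ i, |g i - (fun _ : ℕ => (0 : ℝ)) i| ≤ γ := fun i => by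
    show |g i - 0| ≤ γ
    rw [sub_zero, abs_of_pos (hgi i).1]
    exact (hgi i).2
  have h := historySum_le_of_fadingMemory (fadingMemory_ageMod hℓ hθ0) hθ0 hθ1 hD j
  calc |∑ i ∈ range j, ageMod ℓ θ j i * g i| ≤ ∑ i ∈ range j, |ageMod ℓ θ j i * g i| := abs_sum_le_sum_abs _ _
    _ = ∑ i ∈ range j, ageMod ℓ θ j i * |g i - (fun _ : ℕ => (0 : ℝ)) i| := sum_congr rfl fun i _ => by
        show |ageMod ℓ θ j i * g i| = ageMod ℓ θ j i * |g i - 0|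
        rw [abs_mul, abs_of_nonneg (ageMod_nonneg hℓ hθ0 j i), sub_zero]
    _ ≤ ℓ * γ * (1 - θ)⁻¹ := h

/-- … and for run B's, with `E₀ = ℓγ(1−θ)⁻¹ + C₅`. [folklore] -/
theorem decayBound_EB_age {ℓ θ C₅ : ℝ} (hℓ : 0 ≤ ℓ) (hθ0 : 0 ≤ θ) (hθ1 : θ < 1) (hC₅ : 0 ≤ C₅) (γ κ : ℝ) :
    DecayBound (C := toyC) (EB 0 C₅ θ (ageMod ℓ θ)) (Window γ) (ℓ * γ * (1 - θ)⁻¹ + C₅) κ := by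
  intro g hg U j
  have hA := decayBound_EA_age hℓ hθ0 hθ1 γ κ g hg U j
  change |0 * U + hist (ageMod ℓ θ) g j| ≤ ℓ * γ * (1 - θ)⁻¹ * Real.exp (-(κ * 0)) at hA
  show |0 * U + hist (ageMod ℓ θ) g j - C₅ * θ ^ j| ≤ (ℓ * γ * (1 - θ)⁻¹ + C₅) * Real.exp (-(κ * 0))
  rw [mul_zero, neg_zero, Real.exp_zero, mul_one] at hA ⊢
  have hθj : C₅ * θ ^ j ≤ C₅ := mul_le_of_le_one_right hC₅ (pow_le_one₀ hθ0 hθ1.le)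
  calc |0 * U + hist (ageMod ℓ θ) g j - C₅ * θ ^ j| ≤ |0 * U + hist (ageMod ℓ θ) g j| + |C₅ * θ ^ j| := abs_sub _ _
    _ ≤ ℓ * γ * (1 - θ)⁻¹ + C₅ := by
        rw [abs_of_nonneg (mul_nonneg hC₅ (pow_nonneg hθ0 j))]
        exact add_le_add hA hθj

/-- **THE CARVER'S TARGET SHAPE FAILS AT THE NE5 RATE** for the age-indexed toy pair: for NO constant `E₀′` is
`|E^{(j),A} − E^{(j),B}| ≤ E₀′·θ^j·e^{−κd_j}` for all creation steps, although fading memory holds at rate `ω = θ`.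
[folklore] -/
theorem u3Target_fails_atRate {ℓ θ γ C₅ : ℝ} (hℓ : 0 < ℓ) (hθ : 0 < θ) (hγ : 0 < γ) (hC₅ : 0 ≤ C₅) (κ U E₀' : ℝ) :
    ¬ ∀ j : ℕ, |EA 0 (ageMod ℓ θ) (gHi γ θ) U j - EB 0 C₅ θ (ageMod ℓ θ) (gLo γ) U j|
        ≤ E₀' * θ ^ toyC.scale j * Real.exp (-(κ * toyC.d j)) := by
  intro h
  have hc : 0 < ℓ * (γ / 2) := mul_pos hℓ (half_pos hγ)
  obtain ⟨n, hn⟩ := exists_nat_gt (E₀' / (ℓ * (γ / 2)))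
  have hj := h n
  change |EA 0 (ageMod ℓ θ) (gHi γ θ) U n - EB 0 C₅ θ (ageMod ℓ θ) (gLo γ) U n| ≤ E₀' * θ ^ n * Real.exp (-(κ * 0))
    at hj
  rw [mul_zero, neg_zero, Real.exp_zero, mul_one, runDiff_age_eq] at hj
  have hθn : 0 < θ ^ n := pow_pos hθ n
  have hnn : 0 ≤ ℓ * (γ / 2) * (n : ℝ) * θ ^ n + C₅ * θ ^ n := by positivity
  rw [abs_of_nonneg hnn] at hj
  have h1 : (ℓ * (γ / 2) * (n : ℝ) + C₅) * θ ^ n ≤ E₀' * θ ^ n := by linarith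
  have h2 : ℓ * (γ / 2) * (n : ℝ) + C₅ ≤ E₀' := le_of_mul_le_mul_right h1 hθn
  have h3 : E₀' < (n : ℝ) * (ℓ * (γ / 2)) := (div_lt_iff₀ hc).mp hn
  have h4 : (n : ℝ) * (ℓ * (γ / 2)) = ℓ * (γ / 2) * (n : ℝ) := by ring
  linarith

/-- **EQUAL-RATE PACKAGE (the linear loss is load-bearing).**  For `ℓ, θ, γ > 0`, `θ < 1`, `C₅ ≥ 0`, the age-indexed toy pair
satisfies, at every κ: the printed uniform bound `DecayBound` for both runs; NE9 for both runs with moduli `ℓ·θ^{j−i}`;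
`FadingMemory ℓ θ` of those moduli (rate `ω = θ`, the NE5 rate); `LipBackground` (constant 0); NE5 at rate θ; both coupling
sequences in the window with node U2's discrepancy shape `(γ/2)θ^i`; exact backgrounds — i.e. every hypothesis of the
tree's `T4TowerRateComposition.uRateUpTo_tower_linear` pattern at one cutoff, with `ω = θ` — while the coupling bracket is
EXACTLY `ℓ(γ/2)·j·θ^j`, admits no j-uniform constant at rate θ, and the carver's target shape at rate θ fails for every
constant.  Hence at equal rates the cutoff-linear constant is SHARP; a uniform constant costs a strictly worse rate.
[folklore] -/
theorem equalRate_linearLoss {ℓ θ γ C₅ : ℝ} (hℓ : 0 < ℓ) (hθ0 : 0 < θ) (hθ1 : θ < 1) (hγ : 0 < γ) (hC₅ : 0 ≤ C₅)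
    (κ U : ℝ) :
    DecayBound (C := toyC) (EA 0 (ageMod ℓ θ)) (Window γ) (ℓ * γ * (1 - θ)⁻¹) κ ∧
    DecayBound (C := toyC) (EB 0 C₅ θ (ageMod ℓ θ)) (Window γ) (ℓ * γ * (1 - θ)⁻¹ + C₅) κ ∧
    NE9 (C := toyC) (EA 0 (ageMod ℓ θ)) (Window γ) κ (ageMod ℓ θ) ∧
    NE9 (C := toyC) (EB 0 C₅ θ (ageMod ℓ θ)) (Window γ) κ (ageMod ℓ θ) ∧
    FadingMemory ℓ θ (ageMod ℓ θ) ∧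
    LipBackground (C := toyC) (EA 0 (ageMod ℓ θ)) (Window γ) κ (fun _ _ => 0) ∧
    NE5 (C := toyC) (EA 0 (ageMod ℓ θ)) (EB 0 C₅ θ (ageMod ℓ θ)) (Window γ) κ θ C₅ ∧
    gHi γ θ ∈ Window γ ∧ gLo γ ∈ Window γ ∧
    (∀ i, |gHi γ θ i - gLo γ i| ≤ γ / 2 * θ ^ i) ∧
    toyC.gauge U (toyC.transport U) ≤ 0 ∧
    (∀ j : ℕ, ∑ i ∈ range j, ageMod ℓ θ j i * |gHi γ θ i - gLo γ i| = ℓ * (γ / 2) * (j : ℝ) * θ ^ j) ∧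
    (∀ b : ℝ, ¬ ∀ j : ℕ, ∑ i ∈ range j, ageMod ℓ θ j i * |gHi γ θ i - gLo γ i| ≤ b * θ ^ j) ∧
    ∀ E₀' : ℝ, ¬ ∀ j : ℕ, |EA 0 (ageMod ℓ θ) (gHi γ θ) U j - EB 0 C₅ θ (ageMod ℓ θ) (gLo γ) U j|
          ≤ E₀' * θ ^ toyC.scale j * Real.exp (-(κ * toyC.d j)) :=
  ⟨decayBound_EA_age hℓ.le hθ0.le hθ1 γ κ,
    decayBound_EB_age hℓ.le hθ0.le hθ1 hC₅ γ κ,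
    ne9_EA (ageMod_nonneg' hℓ.le hθ0.le) 0 κ (Window γ),
    ne9_EB (ageMod_nonneg' hℓ.le hθ0.le) 0 C₅ θ κ (Window γ),
    fadingMemory_ageMod hℓ.le hθ0.le,
    lipBackground_EA le_rfl (ageMod ℓ θ) κ (Window γ),
    ne5_EA_EB 0 hC₅ hθ0.le (ageMod ℓ θ) κ (Window γ),
    gHi_mem hγ hθ0.le hθ1.le, gLo_mem hγ,
    fun i => (disc_eq hγ.le hθ0.le i).le,
    by show |U - U| ≤ (0 : ℝ); simp,
    couplingBracket_age_eq hγ.le hθ0.le,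
    couplingBracket_age_not_atRate hℓ hθ0 hγ,
    fun E₀' => u3Target_fails_atRate hℓ hθ0 hγ hC₅ κ U E₀'⟩

/-! ## §7 (v1.2) The memory-rate threshold: the target at the NE5 rate holds iff `ω < θ` -/

/-- General-rate summand of the coupling bracket: `Λ j i·(g^A_i − g^B_i) = ℓ(γ/2)·ω^{j−i}θ^i` for the age-indexed moduli
`ageMod ℓ ω` and node U2's discrepancy shape at rate θ. [folklore] -/
theorem ageTerm_eq_gen (ℓ ω θ γ : ℝ) (j i : ℕ) :
    ageMod ℓ ω j i * (gHi γ θ i - gLo γ i) = ℓ * (γ / 2) * (ω ^ (j - i) * θ ^ i) := by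
  show ℓ * ω ^ (j - i) * (γ / 2 + γ / 2 * θ ^ i - γ / 2) = _
  ring

/-- The difference of the two toy runs' scale-j terms at a common background, for memory rate ω and η-rate θ, IN CLOSED
FORM: `ℓ(γ/2)·Σ_{i<j} ω^{j−i}θ^i + C₅θ^j`. [folklore] -/
theorem runDiff_ageMod_eq (ℓ ω θ γ C₅ U : ℝ) (j : ℕ) :
    EA 0 (ageMod ℓ ω) (gHi γ θ) U j - EB 0 C₅ θ (ageMod ℓ ω) (gLo γ) U j
      = ℓ * (γ / 2) * (∑ i ∈ range j, ω ^ (j - i) * θ ^ i) + C₅ * θ ^ j := by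
  show 0 * U + hist (ageMod ℓ ω) (gHi γ θ) j - (0 * U + hist (ageMod ℓ ω) (gLo γ) j - C₅ * θ ^ j) = _
  have h := hist_sub (ageMod ℓ ω) (gHi γ θ) (gLo γ) j
  have h2 : ∑ i ∈ range j, ageMod ℓ ω j i * (gHi γ θ i - gLo γ i)
      = ℓ * (γ / 2) * ∑ i ∈ range j, ω ^ (j - i) * θ ^ i := by
    rw [mul_sum]
    exact sum_congr rfl fun i _ => ageTerm_eq_gen ℓ ω θ γ j i
  linear_combination h + h2

/-- The MIXED GEOMETRIC SUM `S_j = Σ_{i<j} ω^{j−i}θ^i` obeys `S_{j+1} = ω·S_j + ω·θ^j`. [folklore] -/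
theorem mixedSum_succ (ω θ : ℝ) (j : ℕ) :
    ∑ i ∈ range (j + 1), ω ^ (j + 1 - i) * θ ^ i = ω * (∑ i ∈ range j, ω ^ (j - i) * θ ^ i) + ω * θ ^ j := by
  have h : ∑ i ∈ range j, ω ^ (j + 1 - i) * θ ^ i = ω * ∑ i ∈ range j, ω ^ (j - i) * θ ^ i := by
    rw [mul_sum]
    refine sum_congr rfl fun i hi => ?_
    have hij : j + 1 - i = j - i + 1 := by have := mem_range.mp hi; omega
    rw [hij, pow_succ]
    ring
  rw [sum_range_succ, h, Nat.add_sub_cancel_left, pow_one]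

/-- SLOW MEMORY `θ ≤ ω`: every summand is at least `θ^j`, so `S_j ≥ j·θ^j` — the linear loss of §6 is a LOWER bound.
[folklore] -/
theorem mixedSum_ge {ω θ : ℝ} (hθ : 0 ≤ θ) (hθω : θ ≤ ω) (j : ℕ) :
    (j : ℝ) * θ ^ j ≤ ∑ i ∈ range j, ω ^ (j - i) * θ ^ i := by
  have h : ∀ i ∈ range j, θ ^ j ≤ ω ^ (j - i) * θ ^ i := fun i hi => by
    have hij : i ≤ j := (mem_range.mp hi).le
    calc θ ^ j = θ ^ (j - i) * θ ^ i := by rw [← pow_add, Nat.sub_add_cancel hij]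
      _ ≤ ω ^ (j - i) * θ ^ i :=
          mul_le_mul_of_nonneg_right (pow_le_pow_left₀ hθ hθω _) (pow_nonneg hθ i)
  calc (j : ℝ) * θ ^ j = ∑ _i ∈ range j, θ ^ j := by rw [sum_const, card_range, nsmul_eq_mul]
    _ ≤ ∑ i ∈ range j, ω ^ (j - i) * θ ^ i := sum_le_sum h

/-- The printed uniform bound `DecayBound` HOLDS for run A's age-indexed toy functional at any memory rate `ω ∈ [0, 1)`,
with `E₀ = ℓγ(1−ω)⁻¹` (via the tree's `T4OutputRate.historySum_le_of_fadingMemory` against the zero sequence). [folklore] -/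
theorem decayBound_EA_ageMod {ℓ ω : ℝ} (hℓ : 0 ≤ ℓ) (hω0 : 0 ≤ ω) (hω1 : ω < 1) (γ κ : ℝ) :
    DecayBound (C := toyC) (EA 0 (ageMod ℓ ω)) (Window γ) (ℓ * γ * (1 - ω)⁻¹) κ := by
  intro g hg U j
  show |0 * U + ∑ i ∈ range j, ageMod ℓ ω j i * g i| ≤ ℓ * γ * (1 - ω)⁻¹ * Real.exp (-(κ * 0))
  rw [zero_mul, zero_add, mul_zero, neg_zero, Real.exp_zero, mul_one]
  have hgi := mem_window.mp hg
  have hD : ∀ i, |g i - (fun _ : ℕ => (0 : ℝ)) i| ≤ γ := fun i => by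
    show |g i - 0| ≤ γ
    rw [sub_zero, abs_of_pos (hgi i).1]
    exact (hgi i).2
  have h := historySum_le_of_fadingMemory (fadingMemory_ageMod hℓ hω0) hω0 hω1 hD j
  calc |∑ i ∈ range j, ageMod ℓ ω j i * g i| ≤ ∑ i ∈ range j, |ageMod ℓ ω j i * g i| := abs_sum_le_sum_abs _ _
    _ = ∑ i ∈ range j, ageMod ℓ ω j i * |g i - (fun _ : ℕ => (0 : ℝ)) i| := sum_congr rfl fun i _ => by
        show |ageMod ℓ ω j i * g i| = ageMod ℓ ω j i * |g i - 0|
        rw [abs_mul, abs_of_nonneg (ageMod_nonneg hℓ hω0 j i), sub_zero]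
    _ ≤ ℓ * γ * (1 - ω)⁻¹ := h

/-- … and for run B's (shift `−C₅θ^j`, `θ ∈ [0, 1]`), with `E₀ = ℓγ(1−ω)⁻¹ + C₅`. [folklore] -/
theorem decayBound_EB_ageMod {ℓ ω θ C₅ : ℝ} (hℓ : 0 ≤ ℓ) (hω0 : 0 ≤ ω) (hω1 : ω < 1) (hθ0 : 0 ≤ θ) (hθ1 : θ ≤ 1)
    (hC₅ : 0 ≤ C₅) (γ κ : ℝ) :
    DecayBound (C := toyC) (EB 0 C₅ θ (ageMod ℓ ω)) (Window γ) (ℓ * γ * (1 - ω)⁻¹ + C₅) κ := by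
  intro g hg U j
  have hA := decayBound_EA_ageMod hℓ hω0 hω1 γ κ g hg U j
  change |0 * U + hist (ageMod ℓ ω) g j| ≤ ℓ * γ * (1 - ω)⁻¹ * Real.exp (-(κ * 0)) at hA
  show |0 * U + hist (ageMod ℓ ω) g j - C₅ * θ ^ j| ≤ (ℓ * γ * (1 - ω)⁻¹ + C₅) * Real.exp (-(κ * 0))
  rw [mul_zero, neg_zero, Real.exp_zero, mul_one] at hA ⊢
  have hθj : C₅ * θ ^ j ≤ C₅ := mul_le_of_le_one_right hC₅ (pow_le_one₀ hθ0 hθ1)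
  calc |0 * U + hist (ageMod ℓ ω) g j - C₅ * θ ^ j| ≤ |0 * U + hist (ageMod ℓ ω) g j| + |C₅ * θ ^ j| := abs_sub _ _
    _ ≤ ℓ * γ * (1 - ω)⁻¹ + C₅ := by
        rw [abs_of_nonneg (mul_nonneg hC₅ (pow_nonneg hθ0 j))]
        exact add_le_add hA hθj

/-- **THE MEMORY-RATE THRESHOLD.**  For the age-indexed toy pair with memory rate `ω ≥ 0` (moduli `ℓ·ω^{j−i}`) and node
U2's discrepancy shape at the η-rate `θ > 0` (`ℓ, γ > 0`, `C₅ ≥ 0`), the carver's TARGET SHAPE AT RATE θ —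
`∃ E₀′, ∀ j, |E^{(j),A} − E^{(j),B}| ≤ E₀′·θ^j·e^{−κd_j}` — holds IF AND ONLY IF the memory fades STRICTLY FASTER than the
η-rate, `ω < θ`.  (⇐: uniform constant `ℓ(γ/2)·ω/(θ−ω) + C₅`, by the tree's `T4TowerRateComposition.conv_le_of_lt` (unit t4-ne7-p1, imported and used BY NAME); ⇒: for `θ ≤ ω` the difference is at least
`(ℓ(γ/2)·j + C₅)·θ^j`, by `mixedSum_ge`, and Archimedes.)  [folklore] -/
theorem u3Target_atRate_iff {ℓ ω θ γ C₅ : ℝ} (hℓ : 0 < ℓ) (hω : 0 ≤ ω) (hθ : 0 < θ) (hγ : 0 < γ) (hC₅ : 0 ≤ C₅)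
    (κ U : ℝ) :
    (∃ E₀' : ℝ, ∀ j : ℕ, |EA 0 (ageMod ℓ ω) (gHi γ θ) U j - EB 0 C₅ θ (ageMod ℓ ω) (gLo γ) U j|
        ≤ E₀' * θ ^ toyC.scale j * Real.exp (-(κ * toyC.d j))) ↔ ω < θ := by
  have hc : 0 < ℓ * (γ / 2) := mul_pos hℓ (half_pos hγ)
  constructor
  · rintro ⟨E₀', h⟩
    by_contra hnot
    have hθω : θ ≤ ω := le_of_not_gt hnot
    obtain ⟨n, hn⟩ := exists_nat_gt (E₀' / (ℓ * (γ / 2)))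
    have hj := h n
    change |EA 0 (ageMod ℓ ω) (gHi γ θ) U n - EB 0 C₅ θ (ageMod ℓ ω) (gLo γ) U n| ≤ E₀' * θ ^ n * Real.exp (-(κ * 0))
      at hj
    rw [mul_zero, neg_zero, Real.exp_zero, mul_one, runDiff_ageMod_eq] at hj
    have hS := mixedSum_ge hθ.le hθω n
    have hSnn : 0 ≤ ∑ i ∈ range n, ω ^ (n - i) * θ ^ i :=
      le_trans (mul_nonneg (Nat.cast_nonneg n) (pow_nonneg hθ.le n)) hS
    have h4 : 0 ≤ C₅ * θ ^ n := mul_nonneg hC₅ (pow_nonneg hθ.le n)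
    have hnn : 0 ≤ ℓ * (γ / 2) * (∑ i ∈ range n, ω ^ (n - i) * θ ^ i) + C₅ * θ ^ n :=
      add_nonneg (mul_nonneg hc.le hSnn) h4
    rw [abs_of_nonneg hnn] at hj
    have h1 : ℓ * (γ / 2) * ((n : ℝ) * θ ^ n) ≤ ℓ * (γ / 2) * ∑ i ∈ range n, ω ^ (n - i) * θ ^ i :=
      mul_le_mul_of_nonneg_left hS hc.le
    have h3 : ℓ * (γ / 2) * ((n : ℝ) * θ ^ n) = ℓ * (γ / 2) * (n : ℝ) * θ ^ n := by ring
    have h5 : ℓ * (γ / 2) * (n : ℝ) * θ ^ n ≤ E₀' * θ ^ n := by linarith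
    have h6 : ℓ * (γ / 2) * (n : ℝ) ≤ E₀' := le_of_mul_le_mul_right h5 (pow_pos hθ n)
    have h7 : E₀' < (n : ℝ) * (ℓ * (γ / 2)) := (div_lt_iff₀ hc).mp hn
    have h8 : (n : ℝ) * (ℓ * (γ / 2)) = ℓ * (γ / 2) * (n : ℝ) := by ring
    linarith
  · intro hωθ
    refine ⟨ℓ * (γ / 2) * (ω / (θ - ω)) + C₅, fun j => ?_⟩
    show |EA 0 (ageMod ℓ ω) (gHi γ θ) U j - EB 0 C₅ θ (ageMod ℓ ω) (gLo γ) U j|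
        ≤ (ℓ * (γ / 2) * (ω / (θ - ω)) + C₅) * θ ^ j * Real.exp (-(κ * 0))
    rw [mul_zero, neg_zero, Real.exp_zero, mul_one, runDiff_ageMod_eq]
    have hS := T4TowerRateComposition.conv_le_of_lt hω hωθ j
    have hSnn : 0 ≤ ∑ i ∈ range j, ω ^ (j - i) * θ ^ i :=
      sum_nonneg fun i _ => mul_nonneg (pow_nonneg hω _) (pow_nonneg hθ.le _)
    have h4 : 0 ≤ C₅ * θ ^ j := mul_nonneg hC₅ (pow_nonneg hθ.le j)
    have hnn : 0 ≤ ℓ * (γ / 2) * (∑ i ∈ range j, ω ^ (j - i) * θ ^ i) + C₅ * θ ^ j :=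
      add_nonneg (mul_nonneg hc.le hSnn) h4
    rw [abs_of_nonneg hnn]
    have h1 : ℓ * (γ / 2) * (∑ i ∈ range j, ω ^ (j - i) * θ ^ i) ≤ ℓ * (γ / 2) * (ω / (θ - ω) * θ ^ j) :=
      mul_le_mul_of_nonneg_left hS hc.le
    have h2 : (ℓ * (γ / 2) * (ω / (θ - ω)) + C₅) * θ ^ j = ℓ * (γ / 2) * (ω / (θ - ω) * θ ^ j) + C₅ * θ ^ j := by
      ring
    linarith

/-- CLOSED FORM of the mixed sum off the diagonal `ω ≠ θ`: `S_j = ω·(θ^j − ω^j)/(θ − ω)` (from the recursion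
`mixedSum_succ`); at `ω = θ` it is `j·θ^j` (§6, `couplingBracket_age_eq`). [folklore] -/
theorem mixedSum_closed {ω θ : ℝ} (h : ω ≠ θ) (j : ℕ) :
    ∑ i ∈ range j, ω ^ (j - i) * θ ^ i = ω * (θ ^ j - ω ^ j) / (θ - ω) := by
  have hd : θ - ω ≠ 0 := sub_ne_zero.mpr (Ne.symm h)
  induction j with
  | zero => simp
  | succ j ih =>
    rw [mixedSum_succ, ih]
    field_simp
    ring

/-- The uniform constant `ω/(θ−ω)` of the tree's `T4TowerRateComposition.conv_le_of_lt` / `historySum_le_rate` (at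
`C₉ = D = 1`) is SHARP as a supremum over j (for `0 < ω < θ`): every smaller constant is beaten at some creation step.
[folklore] -/
theorem mixedSum_const_sharp {ω θ c' : ℝ} (hω : 0 < ω) (hωθ : ω < θ) (hc' : c' < ω / (θ - ω)) :
    ∃ j : ℕ, c' * θ ^ j < ∑ i ∈ range j, ω ^ (j - i) * θ ^ i := by
  have hθ : 0 < θ := hω.trans hωθ
  have hd : 0 < θ - ω := sub_pos.mpr hωθ
  have hc : 0 < ω / (θ - ω) := div_pos hω hd
  have hr1 : ω / θ < 1 := (div_lt_one hθ).mpr hωθ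
  have hx : 0 < 1 - c' / (ω / (θ - ω)) := by
    have : c' / (ω / (θ - ω)) < 1 := (div_lt_one hc).mpr hc'
    linarith
  obtain ⟨n, hn⟩ := exists_pow_lt_of_lt_one hx hr1
  refine ⟨n, ?_⟩
  rw [mixedSum_closed hωθ.ne n]
  have hθn : 0 < θ ^ n := pow_pos hθ n
  have hωn : ω ^ n = (ω / θ) ^ n * θ ^ n := by
    rw [div_pow, div_mul_cancel₀ _ (pow_ne_zero n hθ.ne')]
  -- from `hn`: multiplying by the positive constant, `c' < (ω/(θ−ω))·(1 − (ω/θ)^n)`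
  have h0 : ω / (θ - ω) * (c' / (ω / (θ - ω))) = c' := mul_div_cancel₀ _ hc.ne'
  have h1 : c' < ω / (θ - ω) * (1 - (ω / θ) ^ n) := by
    have := mul_lt_mul_of_pos_left hn hc
    nlinarith
  have h2 : ω * (θ ^ n - ω ^ n) / (θ - ω) = ω / (θ - ω) * (1 - (ω / θ) ^ n) * θ ^ n := by
    rw [hωn]
    field_simp
  rw [h2]
  exact lt_of_lt_of_eq (mul_lt_mul_of_pos_right h1 hθn) rfl

/-- **MEMORY-RATE PACKAGE.**  For `ℓ, γ > 0`, memory rate `ω ∈ [0, 1)`, η-rate `θ ∈ ]0, 1[`, `C₅ ≥ 0`, the age-indexed toy pair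
satisfies, at every κ: the printed uniform bound `DecayBound` for both runs; NE9 for both runs with moduli `ℓ·ω^{j−i}`;
`FadingMemory ℓ ω` of those moduli; `LipBackground` (constant 0); NE5 at rate θ; both coupling sequences in the window with
node U2's discrepancy shape `(γ/2)θ^i`; exact backgrounds; the two runs' scale-j terms differ by `ℓ(γ/2)·S_j + C₅θ^j` with
`S_j` the mixed geometric sum — and the carver's target shape AT THE NE5 RATE θ holds IFF `ω < θ`.  READING: on this family
the hypothesis `ω < θ` of the tree's `T4TowerRateComposition.historySum_le_rate` is NECESSARY, not only sufficient, for a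
cutoff-uniform node-U3 output at the NE5 rate; §6 (`ω = θ`) is the boundary case, §4 (no fading memory) the extreme one.
[folklore] -/
theorem memoryRate_threshold {ℓ ω θ γ C₅ : ℝ} (hℓ : 0 < ℓ) (hω0 : 0 ≤ ω) (hω1 : ω < 1) (hθ0 : 0 < θ) (hθ1 : θ < 1)
    (hγ : 0 < γ) (hC₅ : 0 ≤ C₅) (κ U : ℝ) :
    DecayBound (C := toyC) (EA 0 (ageMod ℓ ω)) (Window γ) (ℓ * γ * (1 - ω)⁻¹) κ ∧
    DecayBound (C := toyC) (EB 0 C₅ θ (ageMod ℓ ω)) (Window γ) (ℓ * γ * (1 - ω)⁻¹ + C₅) κ ∧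
    NE9 (C := toyC) (EA 0 (ageMod ℓ ω)) (Window γ) κ (ageMod ℓ ω) ∧
    NE9 (C := toyC) (EB 0 C₅ θ (ageMod ℓ ω)) (Window γ) κ (ageMod ℓ ω) ∧
    FadingMemory ℓ ω (ageMod ℓ ω) ∧
    LipBackground (C := toyC) (EA 0 (ageMod ℓ ω)) (Window γ) κ (fun _ _ => 0) ∧
    NE5 (C := toyC) (EA 0 (ageMod ℓ ω)) (EB 0 C₅ θ (ageMod ℓ ω)) (Window γ) κ θ C₅ ∧
    gHi γ θ ∈ Window γ ∧ gLo γ ∈ Window γ ∧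
    (∀ i, |gHi γ θ i - gLo γ i| ≤ γ / 2 * θ ^ i) ∧
    toyC.gauge U (toyC.transport U) ≤ 0 ∧
    (∀ j : ℕ, EA 0 (ageMod ℓ ω) (gHi γ θ) U j - EB 0 C₅ θ (ageMod ℓ ω) (gLo γ) U j
        = ℓ * (γ / 2) * (∑ i ∈ range j, ω ^ (j - i) * θ ^ i) + C₅ * θ ^ j) ∧
    ((∃ E₀' : ℝ, ∀ j : ℕ, |EA 0 (ageMod ℓ ω) (gHi γ θ) U j - EB 0 C₅ θ (ageMod ℓ ω) (gLo γ) U j|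
        ≤ E₀' * θ ^ toyC.scale j * Real.exp (-(κ * toyC.d j))) ↔ ω < θ) :=
  ⟨decayBound_EA_ageMod hℓ.le hω0 hω1 γ κ,
    decayBound_EB_ageMod hℓ.le hω0 hω1 hθ0.le hθ1.le hC₅ γ κ,
    ne9_EA (ageMod_nonneg' hℓ.le hω0) 0 κ (Window γ),
    ne9_EB (ageMod_nonneg' hℓ.le hω0) 0 C₅ θ κ (Window γ),
    fadingMemory_ageMod hℓ.le hω0,
    lipBackground_EA le_rfl (ageMod ℓ ω) κ (Window γ),
    ne5_EA_EB 0 hC₅ hθ0.le (ageMod ℓ ω) κ (Window γ),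
    gHi_mem hγ hθ0.le hθ1.le, gLo_mem hγ,
    fun i => (disc_eq hγ.le hθ0.le i).le,
    by show |U - U| ≤ (0 : ℝ); simp,
    runDiff_ageMod_eq ℓ ω θ γ C₅ U,
    u3Target_atRate_iff hℓ hω0 hθ0 hγ hC₅ κ U⟩

end Literature.MathematicalPhysics.QuantumFieldTheory.Balaban1983to89.T4OutputRateWitness

end
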